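import Summits.ResolutionOfSingularities.ResolutionOfSingularities.Theorems.FrobeniusLadderFInjectiveMacaulayficationFedderSingletonSupport
import Summits.ResolutionOfSingularities.ResolutionOfSingularities.Theorems.FrobeniusLadderFInjectiveMacaulayficationHFedderCertificates
import Mathlib.RingTheory.MvPolynomial.WeightedHomogeneous
import Mathlib.Tactic.Ring
import Mathlib.Tactic.IntervalCases
import HarnessLib

/-!
# Fedder witnesses for the cone over idea-2's residual point `P = V(x²+y³−wU, Z²+wU³+w³) ⊂ 𝔸⁵` in characteristic `5`
# (crux `FInjectiveMacaulayfication`, (H4-gd) calibration data G6ᵍ-P, first half: «Bad(X) = {vertex}»)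

Support file for crux stmt-ResolutionOfSingularities-15315 (`FrobeniusLadder.FInjectiveMacaulayfication`), chain w45a,
seat res-L1-w45a-stub-4 (res-L1-w45a-plan-1 R8.1: K-P + `…PConeOffVertex`). [OURS · L1 W4.5a] — NOT a statement of the
manuscript [claim: Hironaka2017]; AI-written, weaker than expert review.

THE SPECIMEN. `X = Spec k[x,y,w,Z,U]/(F₁,F₂)`, `F₁ = x² + y³ − wU`, `F₂ = Z² + wU³ + w³` (variables `X 0,…,X 4` in this
order), quasi-homogeneous for the weights `(15,10,18,27,12)` (degrees `30`, `54`): the `W`-chart of `Bl_C` of the cusp family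
`f_cusp = z²+(x²+y³)³+w⁵` (idea-2 ANSWERS-r3 §3.2), the first codimension-2 point of the crux. Its singular locus is NOT the
vertex (it is the union of the two cones `L = {x=y=w=Z=0}` and `C′ = {w=Z=U=0, x²+y³=0}`), but its NON-F-PURE locus is: this file
proves, for `p = 5`, that the complete-intersection Fedder element `(F₁F₂)^(p-1)` [Fedder1983, Prop. 2.1] passes Fedder's test at
every `K`-point `b` of `𝔸⁵` with `b_U ≠ 0`, or `b_w ≠ 0`, or `b_x ≠ 0` — and every point of `X` other than the vertex is of one
of these three kinds (`…PConeOffVertex`). The three WITNESS MONOMIALS `x⁴w⁴Z⁴U⁸`, `x⁴w⁸Z⁴U²`, `x⁸w⁴Z⁴U³` of `(F₁F₂)⁴` (coefficients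
`36, 36, 12`, units mod `5`) have all exponents `< 5` except on the named coordinate, and each is ALONE in its residue class
mod `5` by WEIGHT COUNTING (the class of a monomial of the weighted-homogeneous polynomial `(F₁F₂)⁴`, degree `336`, is pinned by
`15q₀+10q₁+18q₂+27q₃+12q₄ ∈ {12, 18, 15}`, each with a unique solution) — so no 225-term expansion is needed: one coefficient
each, read off the 75-term `y`-free part `((x²−wU)F₂)⁴` (`ring`) after `F₁⁴ = (x²−wU)⁴ + y³·(…)`.

* (generic input, `…FedderSingletonSupport.fedder_of_singleton_support`: if `γ₀ ∈ supp F^(p-1)` is alone in its class mod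
  `p` then Fedder's test for `F ⊗ K` holds at every `b` with `bᵢ ≠ 0` whenever `γ₀ᵢ ≥ p`);
* §2 the three grouped expansions (`ring`, generic commutative ring) and the binomial split `F₁⁴ = (x²−wU)⁴ + y³·R`;
* §3 the coefficients `36, 36, 12` of the witnesses in `(F₁F₂)⁴` (`coeff_witness_U/w/x`);
* §4 weighted homogeneity (`isWeightedHomogeneous_F₁/F₂/pow4`) and the singleton property of the three classes
  (`arith_t`, `arith_witness`: bounded case analysis);
* §5 `pCone_fedder_U/w/x` — Fedder's test at `K`-points with `b 4 ≠ 0` / `b 2 ≠ 0` / `b 0 ≠ 0`, characteristic `5`.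

No definitions, no named facts. [cite: Fedder1983, Prop. 1.7 and Prop. 2.1 for the criterion; the computation is OURS]
-/

-- single-problem summit: the doubled namespace component is forced
set_option linter.dupNamespace false

noncomputable section

namespace Summit.ResolutionOfSingularities.ResolutionOfSingularities.Theorems.FInjectiveMacaulayfication.PConeFedderData

open MvPolynomial
open Summit.ResolutionOfSingularities.ResolutionOfSingularities.Theorems.FInjectiveMacaulayfication
open FedderSingletonSupport HFedderCertificates

/-! ## §2 The expansions (generic commutative ring) -/

/-- `F₁⁴ = (x²−wU)⁴ + y³·R`: the `y`-free part of `(F₁F₂)⁴` is `((x²−wU)F₂)⁴`. [folklore] -/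
theorem pow4_split_y {R : Type*} [CommRing R] (x y w Z U : R) :
    ((x ^ 2 + y ^ 3 - w * U) * (Z ^ 2 + w * U ^ 3 + w ^ 3)) ^ 4 =
      ((x ^ 2 - w * U) * (Z ^ 2 + w * U ^ 3 + w ^ 3)) ^ 4 +
        y ^ 3 * ((4 * (x ^ 2 - w * U) ^ 3 + 6 * (x ^ 2 - w * U) ^ 2 * y ^ 3 + 4 * (x ^ 2 - w * U) * y ^ 6 + y ^ 9) *
          (Z ^ 2 + w * U ^ 3 + w ^ 3) ^ 4) := by
  ring

set_option maxHeartbeats 1600000 in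
/-- The `y`-free part of `(F₁F₂)⁴`, grouped for the `U`-witness `x⁴w⁴Z⁴U⁸` (coefficient `36`): every other monomial is divisible by `x⁵`, `w⁵` or `Z⁵`. [folklore] -/
theorem expand_y0_U {R : Type*} [CommRing R] (x w Z U : R) :
    ((x ^ 2 - w * U) * (Z ^ 2 + w * U ^ 3 + w ^ 3)) ^ 4 =
      36 * (x ^ 4 * w ^ 4 * Z ^ 4 * U ^ 8) +
      x ^ 5 * (((((-4 * x * w * Z ^ 8 * U) + ((-16 * x * w ^ 2 * Z ^ 6 * U ^ 4) + (-24 * x * w ^ 3 * Z ^ 4 * U ^ 7))) + (((-16 * x * w ^ 4 * Z ^ 2 * U ^ 10) + (-16 * x * w ^ 4 * Z ^ 6 * U)) + ((-4 * x * w ^ 5 * U ^ 13) + (-48 * x * w ^ 5 * Z ^ 4 * U ^ 4)))) + ((((-48 * x * w ^ 6 * Z ^ 2 * U ^ 7) + (-16 * x * w ^ 7 * U ^ 10)) + ((-24 * x * w ^ 7 * Z ^ 4 * U) + (-48 * x * w ^ 8 * Z ^ 2 * U ^ 4))) + (((-24 * x * w ^ 9 * U ^ 7) + (-16 * x * w ^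 10 * Z ^ 2 * U)) + ((-16 * x * w ^ 11 * U ^ 4) + (-4 * x * w ^ 13 * U))))) + ((((x ^ 3 * Z ^ 8) + ((4 * x ^ 3 * w * Z ^ 6 * U ^ 3) + (6 * x ^ 3 * w ^ 2 * Z ^ 4 * U ^ 6))) + (((4 * x ^ 3 * w ^ 3 * Z ^ 2 * U ^ 9) + (4 * x ^ 3 * w ^ 3 * Z ^ 6)) + ((x ^ 3 * w ^ 4 * U ^ 12) + (12 * x ^ 3 * w ^ 4 * Z ^ 4 * U ^ 3)))) + ((((12 * x ^ 3 * w ^ 5 * Z ^ 2 * U ^ 6) + (4 * x ^ 3 * w ^ 6 * U ^ 9)) + ((6 * x ^ 3 * w ^ 6 * Z ^ 4) + (12 * x ^ 3 * w ^ 7 * Z ^ 2 * U ^ 3))) + (((6 * x ^ 3 * w ^ 8 * U ^ 6) + (4 * x ^ 3 * w ^ 9 * Z ^ 2)) + ((4 * x ^ 3 * w ^ 10 * U ^ 3) + (x ^ 3 * w ^ 12)))))) +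
      w ^ 5 * ((((((4 * Z ^ 6 * U ^ 7) + (6 * w * Z ^ 4 * U ^ 10)) + ((4 * w ^ 2 * Z ^ 2 * U ^ 13) + (4 * w ^ 2 * Z ^ 6 * U ^ 4))) + (((w ^ 3 * U ^ 16) + (12 * w ^ 3 * Z ^ 4 * U ^ 7)) + ((12 * w ^ 4 * Z ^ 2 * U ^ 10) + ((4 * w ^ 5 * U ^ 13) + (6 * w ^ 5 * Z ^ 4 * U ^ 4))))) + ((((12 * w ^ 6 * Z ^ 2 * U ^ 7) + (6 * w ^ 7 * U ^ 10)) + ((4 * w ^ 8 * Z ^ 2 * U ^ 4) + ((4 * w ^ 9 * U ^ 7) + (w ^ 11 * U ^ 4)))) + (((-24 * x ^ 2 * Z ^ 4 * U ^ 9) + (-16 * x ^ 2 * w * Z ^ 2 * U ^ 12)) + ((-16 * x ^ 2 * w * Z ^ 6 * U ^ 3) + ((-4 * x ^ 2 * w ^ 2 * U ^ 15) + (-48 * x ^ 2 * w ^ 2 * Z ^ 4 * U ^ 6)))))) + (((((-48 * x ^ 2 * w ^ 3 * Z ^ 2 * U ^ 9) + (-16 * x ^ 2 * w ^ 4 * U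 ^ 12)) + ((-24 * x ^ 2 * w ^ 4 * Z ^ 4 * U ^ 3) + ((-48 * x ^ 2 * w ^ 5 * Z ^ 2 * U ^ 6) + (-24 * x ^ 2 * w ^ 6 * U ^ 9)))) + (((-16 * x ^ 2 * w ^ 7 * Z ^ 2 * U ^ 3) + (-16 * x ^ 2 * w ^ 8 * U ^ 6)) + ((-4 * x ^ 2 * w ^ 10 * U ^ 3) + ((24 * x ^ 4 * Z ^ 2 * U ^ 11) + (24 * x ^ 4 * Z ^ 6 * U ^ 2))))) + ((((6 * x ^ 4 * w * U ^ 14) + (72 * x ^ 4 * w * Z ^ 4 * U ^ 5)) + ((72 * x ^ 4 * w ^ 2 * Z ^ 2 * U ^ 8) + ((24 * x ^ 4 * w ^ 3 * U ^ 11) + (36 * x ^ 4 * w ^ 3 * Z ^ 4 * U ^ 2)))) + (((72 * x ^ 4 * w ^ 4 * Z ^ 2 * U ^ 5) + (36 * x ^ 4 * w ^ 5 * U ^ 8)) + ((24 * x ^ 4 * w ^ 6 * Z ^ 2 * U ^ 2) + ((24 * x ^ 4 * w ^ 7 * U ^ 5) + (6 * x ^ 4 * w ^ 9 * U ^ 2)))))))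 +
      Z ^ 5 * (((w ^ 4 * Z ^ 3 * U ^ 4) + (-4 * x ^ 2 * w ^ 3 * Z ^ 3 * U ^ 3)) + ((-16 * x ^ 2 * w ^ 4 * Z * U ^ 6) + ((6 * x ^ 4 * w ^ 2 * Z ^ 3 * U ^ 2) + (24 * x ^ 4 * w ^ 3 * Z * U ^ 5)))) := by
  ring

set_option maxHeartbeats 1600000 in
/-- The same polynomial grouped for the `w`-witness `x⁴w⁸Z⁴U²` (coefficient `36`): every other monomial is divisible by `x⁵`, `Z⁵`, `U³` or `w⁹`. [folklore] -/
theorem expand_y0_w {R : Type*} [CommRing R] (x w Z U : R) :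
    ((x ^ 2 - w * U) * (Z ^ 2 + w * U ^ 3 + w ^ 3)) ^ 4 =
      36 * (x ^ 4 * w ^ 8 * Z ^ 4 * U ^ 2) +
      x ^ 5 * (((((-4 * x * w * Z ^ 8 * U) + ((-16 * x * w ^ 2 * Z ^ 6 * U ^ 4) + (-24 * x * w ^ 3 * Z ^ 4 * U ^ 7))) + (((-16 * x * w ^ 4 * Z ^ 2 * U ^ 10) + (-16 * x * w ^ 4 * Z ^ 6 * U)) + ((-4 * x * w ^ 5 * U ^ 13) + (-48 * x * w ^ 5 * Z ^ 4 * U ^ 4)))) + ((((-48 * x * w ^ 6 * Z ^ 2 * U ^ 7) + (-16 * x * w ^ 7 * U ^ 10)) + ((-24 * x * w ^ 7 * Z ^ 4 * U) + (-48 * x * w ^ 8 * Z ^ 2 * U ^ 4))) + (((-24 * x * w ^ 9 * U ^ 7) + (-16 * x * w ^ 10 * Z ^ 2 * U)) + ((-16 * x * w ^ 11 * U ^ 4) + (-4 * x * w ^ 13 * U))))) + ((((x ^ 3 * Z ^ 8) + ((4 * x ^ 3 * w * Z ^ 6 * U ^ 3) + (6 * x ^ 3 * w ^ 2 * Z ^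 4 * U ^ 6))) + (((4 * x ^ 3 * w ^ 3 * Z ^ 2 * U ^ 9) + (4 * x ^ 3 * w ^ 3 * Z ^ 6)) + ((x ^ 3 * w ^ 4 * U ^ 12) + (12 * x ^ 3 * w ^ 4 * Z ^ 4 * U ^ 3)))) + ((((12 * x ^ 3 * w ^ 5 * Z ^ 2 * U ^ 6) + (4 * x ^ 3 * w ^ 6 * U ^ 9)) + ((6 * x ^ 3 * w ^ 6 * Z ^ 4) + (12 * x ^ 3 * w ^ 7 * Z ^ 2 * U ^ 3))) + (((6 * x ^ 3 * w ^ 8 * U ^ 6) + (4 * x ^ 3 * w ^ 9 * Z ^ 2)) + ((4 * x ^ 3 * w ^ 10 * U ^ 3) + (x ^ 3 * w ^ 12)))))) +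
      Z ^ 5 * ((((w ^ 4 * Z ^ 3 * U ^ 4) + (4 * w ^ 5 * Z * U ^ 7)) + ((4 * w ^ 7 * Z * U ^ 4) + (-4 * x ^ 2 * w ^ 3 * Z ^ 3 * U ^ 3))) + (((-16 * x ^ 2 * w ^ 4 * Z * U ^ 6) + (-16 * x ^ 2 * w ^ 6 * Z * U ^ 3)) + ((6 * x ^ 4 * w ^ 2 * Z ^ 3 * U ^ 2) + ((24 * x ^ 4 * w ^ 3 * Z * U ^ 5) + (24 * x ^ 4 * w ^ 5 * Z * U ^ 2))))) +
      U ^ 3 * ((((((6 * w ^ 6 * Z ^ 4 * U ^ 7) + (4 * w ^ 7 * Z ^ 2 * U ^ 10)) + ((w ^ 8 * U ^ 13) + (12 * w ^ 8 * Z ^ 4 * U ^ 4))) + (((12 * w ^ 9 * Z ^ 2 * U ^ 7) + (4 * w ^ 10 * U ^ 10)) + ((6 * w ^ 10 * Z ^ 4 * U) + (12 * w ^ 11 * Z ^ 2 * U ^ 4)))) + ((((6 * w ^ 12 * U ^ 7) + (4 * w ^ 13 * Z ^ 2 * U)) + ((4 * w ^ 14 * U ^ 4) + (w ^ 16 * U)))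 + (((-24 * x ^ 2 * w ^ 5 * Z ^ 4 * U ^ 6) + (-16 * x ^ 2 * w ^ 6 * Z ^ 2 * U ^ 9)) + ((-4 * x ^ 2 * w ^ 7 * U ^ 12) + (-48 * x ^ 2 * w ^ 7 * Z ^ 4 * U ^ 3))))) + (((((-48 * x ^ 2 * w ^ 8 * Z ^ 2 * U ^ 6) + (-16 * x ^ 2 * w ^ 9 * U ^ 9)) + ((-24 * x ^ 2 * w ^ 9 * Z ^ 4) + (-48 * x ^ 2 * w ^ 10 * Z ^ 2 * U ^ 3))) + (((-24 * x ^ 2 * w ^ 11 * U ^ 6) + (-16 * x ^ 2 * w ^ 12 * Z ^ 2)) + ((-16 * x ^ 2 * w ^ 13 * U ^ 3) + (-4 * x ^ 2 * w ^ 15)))) + ((((36 * x ^ 4 * w ^ 4 * Z ^ 4 * U ^ 5) + (24 * x ^ 4 * w ^ 5 * Z ^ 2 * U ^ 8)) + ((6 * x ^ 4 * w ^ 6 * U ^ 11) + (72 * x ^ 4 * w ^ 6 * Z ^ 4 * U ^ 2))) + (((72 * x ^ 4 * w ^ 7 * Z ^ 2 * U ^ 5) + (24 * x ^ 4 * w ^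 8 * U ^ 8)) + ((72 * x ^ 4 * w ^ 9 * Z ^ 2 * U ^ 2) + ((36 * x ^ 4 * w ^ 10 * U ^ 5) + (24 * x ^ 4 * w ^ 12 * U ^ 2))))))) +
      w ^ 9 * ((24 * x ^ 4 * w ^ 2 * Z ^ 2 * U ^ 2) + (6 * x ^ 4 * w ^ 5 * U ^ 2)) := by
  ring

set_option maxHeartbeats 1600000 in
/-- The same polynomial grouped for the `x`-witness `x⁸w⁴Z⁴U³` (coefficient `12`): every other monomial is divisible by `w⁵`, `Z⁵` or `U⁵`. [folklore] -/
theorem expand_y0_x {R : Type*} [CommRing R] (x w Z U : R) :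
    ((x ^ 2 - w * U) * (Z ^ 2 + w * U ^ 3 + w ^ 3)) ^ 4 =
      12 * (x ^ 8 * w ^ 4 * Z ^ 4 * U ^ 3) +
      w ^ 5 * ((((((4 * Z ^ 6 * U ^ 7) + ((6 * w * Z ^ 4 * U ^ 10) + (4 * w ^ 2 * Z ^ 2 * U ^ 13))) + (((4 * w ^ 2 * Z ^ 6 * U ^ 4) + (w ^ 3 * U ^ 16)) + ((12 * w ^ 3 * Z ^ 4 * U ^ 7) + (12 * w ^ 4 * Z ^ 2 * U ^ 10)))) + (((4 * w ^ 5 * U ^ 13) + ((6 * w ^ 5 * Z ^ 4 * U ^ 4) + (12 * w ^ 6 * Z ^ 2 * U ^ 7))) + (((6 * w ^ 7 * U ^ 10) + (4 * w ^ 8 * Z ^ 2 * U ^ 4)) + ((4 * w ^ 9 * U ^ 7) + (w ^ 11 * U ^ 4))))) + ((((-24 * x ^ 2 * Z ^ 4 * U ^ 9) + ((-16 * x ^ 2 * w * Z ^ 2 * U ^ 12) + (-16 * x ^ 2 * w * Z ^ 6 * U ^ 3))) + (((-4 * x ^ 2 * w ^ 2 * U ^ 15) + (-48 * x ^ 2 *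 w ^ 2 * Z ^ 4 * U ^ 6)) + ((-48 * x ^ 2 * w ^ 3 * Z ^ 2 * U ^ 9) + (-16 * x ^ 2 * w ^ 4 * U ^ 12)))) + (((-24 * x ^ 2 * w ^ 4 * Z ^ 4 * U ^ 3) + ((-48 * x ^ 2 * w ^ 5 * Z ^ 2 * U ^ 6) + (-24 * x ^ 2 * w ^ 6 * U ^ 9))) + (((-16 * x ^ 2 * w ^ 7 * Z ^ 2 * U ^ 3) + (-16 * x ^ 2 * w ^ 8 * U ^ 6)) + ((-4 * x ^ 2 * w ^ 10 * U ^ 3) + (24 * x ^ 4 * Z ^ 2 * U ^ 11)))))) + (((((24 * x ^ 4 * Z ^ 6 * U ^ 2) + ((6 * x ^ 4 * w * U ^ 14) + (72 * x ^ 4 * w * Z ^ 4 * U ^ 5))) + (((72 * x ^ 4 * w ^ 2 * Z ^ 2 * U ^ 8) + (24 * x ^ 4 * w ^ 3 * U ^ 11)) + ((36 * x ^ 4 * w ^ 3 * Z ^ 4 * U ^ 2) + (72 * x ^ 4 * w ^ 4 * Z ^ 2 * U ^ 5)))) + (((36 * x ^ 4 * w ^ 5 * U ^ 8) + ((24 *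 x ^ 4 * w ^ 6 * Z ^ 2 * U ^ 2) + (24 * x ^ 4 * w ^ 7 * U ^ 5))) + (((6 * x ^ 4 * w ^ 9 * U ^ 2) + (-4 * x ^ 6 * U ^ 13)) + ((-48 * x ^ 6 * Z ^ 4 * U ^ 4) + (-48 * x ^ 6 * w * Z ^ 2 * U ^ 7))))) + ((((-16 * x ^ 6 * w ^ 2 * U ^ 10) + ((-24 * x ^ 6 * w ^ 2 * Z ^ 4 * U) + (-48 * x ^ 6 * w ^ 3 * Z ^ 2 * U ^ 4))) + (((-24 * x ^ 6 * w ^ 4 * U ^ 7) + (-16 * x ^ 6 * w ^ 5 * Z ^ 2 * U)) + ((-16 * x ^ 6 * w ^ 6 * U ^ 4) + (-4 * x ^ 6 * w ^ 8 * U)))) + ((((12 * x ^ 8 * Z ^ 2 * U ^ 6) + (4 * x ^ 8 * w * U ^ 9)) + ((6 * x ^ 8 * w * Z ^ 4) + (12 * x ^ 8 * w ^ 2 * Z ^ 2 * U ^ 3))) + (((6 * x ^ 8 * w ^ 3 * U ^ 6) + (4 * x ^ 8 * w ^ 4 * Z ^ 2)) + ((4 * x ^ 8 * w ^ 5 * U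 ^ 3) + (x ^ 8 * w ^ 7))))))) +
      Z ^ 5 * ((((w ^ 4 * Z ^ 3 * U ^ 4) + (-4 * x ^ 2 * w ^ 3 * Z ^ 3 * U ^ 3)) + ((-16 * x ^ 2 * w ^ 4 * Z * U ^ 6) + ((6 * x ^ 4 * w ^ 2 * Z ^ 3 * U ^ 2) + (24 * x ^ 4 * w ^ 3 * Z * U ^ 5)))) + (((-4 * x ^ 6 * w * Z ^ 3 * U) + ((-16 * x ^ 6 * w ^ 2 * Z * U ^ 4) + (-16 * x ^ 6 * w ^ 4 * Z * U))) + ((x ^ 8 * Z ^ 3) + ((4 * x ^ 8 * w * Z * U ^ 3) + (4 * x ^ 8 * w ^ 3 * Z))))) +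
      U ^ 5 * (((36 * x ^ 4 * w ^ 4 * Z ^ 4 * U ^ 3) + ((-24 * x ^ 6 * w ^ 3 * Z ^ 4 * U ^ 2) + (-16 * x ^ 6 * w ^ 4 * Z ^ 2 * U ^ 5))) + ((6 * x ^ 8 * w ^ 2 * Z ^ 4 * U) + ((4 * x ^ 8 * w ^ 3 * Z ^ 2 * U ^ 4) + (x ^ 8 * w ^ 4 * U ^ 7)))) := by
  ring

/-! ## §3 The three witness coefficients in `(F₁F₂)⁴` -/

/-- Monomials of `k[X₀,…,X₄]` from exponent vectors. [folklore] -/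
theorem monomial_five {k : Type} [CommSemiring k] (a b c d e : ℕ) :
    (monomial (Finsupp.equivFunOnFinite.symm ![a, b, c, d, e]) (1 : k) : MvPolynomial (Fin 5) k) =
      X 0 ^ a * X 1 ^ b * X 2 ^ c * X 3 ^ d * X 4 ^ e := by
  rw [monomial_eq, C_1, one_mul, Finsupp.prod_fintype _ _ (fun i => pow_zero _)]
  simp only [Fin.prod_univ_five, Finsupp.coe_equivFunOnFinite_symm, Matrix.cons_val_zero, Matrix.cons_val_one,
    Matrix.cons_val]

section Coeff

variable {k : Type} [Field k]

/-- `x⁴w⁴Z⁴U⁸` has coefficient `36` in `(F₁F₂)⁴`. [folklore] -/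
theorem coeff_witness_U (F₁ F₂ : MvPolynomial (Fin 5) k)
    (hF₁ : F₁ = X 0 ^ 2 + X 1 ^ 3 - X 2 * X 4) (hF₂ : F₂ = X 3 ^ 2 + X 2 * X 4 ^ 3 + X 2 ^ 3) :
    coeff (Finsupp.equivFunOnFinite.symm ![4, 0, 4, 4, 8]) ((F₁ * F₂) ^ 4) = 36 := by
  rw [hF₁, hF₂, pow4_split_y, expand_y0_U, coeff_add, coeff_add, coeff_add, coeff_add,
    coeff_X_pow_mul_eq_zero _ 1 3 (by simp), coeff_X_pow_mul_eq_zero _ 0 5 (by simp),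
    coeff_X_pow_mul_eq_zero _ 2 5 (by simp), coeff_X_pow_mul_eq_zero _ 3 5 (by simp),
    add_zero, add_zero, add_zero, add_zero]
  have hm : (X 0 ^ 4 * X 2 ^ 4 * X 3 ^ 4 * X 4 ^ 8 : MvPolynomial (Fin 5) k) =
      monomial (Finsupp.equivFunOnFinite.symm ![4, 0, 4, 4, 8]) 1 := by
    rw [monomial_five, pow_zero, mul_one]
  rw [hm, show (36 : MvPolynomial (Fin 5) k) = C 36 from (map_ofNat C 36).symm, coeff_C_mul, coeff_monomial,
    if_pos rfl, mul_one]

/-- `x⁴w⁸Z⁴U²` has coefficient `36` in `(F₁F₂)⁴`. [folklore] -/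
theorem coeff_witness_w (F₁ F₂ : MvPolynomial (Fin 5) k)
    (hF₁ : F₁ = X 0 ^ 2 + X 1 ^ 3 - X 2 * X 4) (hF₂ : F₂ = X 3 ^ 2 + X 2 * X 4 ^ 3 + X 2 ^ 3) :
    coeff (Finsupp.equivFunOnFinite.symm ![4, 0, 8, 4, 2]) ((F₁ * F₂) ^ 4) = 36 := by
  rw [hF₁, hF₂, pow4_split_y, expand_y0_w, coeff_add, coeff_add, coeff_add, coeff_add, coeff_add,
    coeff_X_pow_mul_eq_zero _ 1 3 (by simp), coeff_X_pow_mul_eq_zero _ 0 5 (by simp),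
    coeff_X_pow_mul_eq_zero _ 3 5 (by simp), coeff_X_pow_mul_eq_zero _ 4 3 (by simp),
    coeff_X_pow_mul_eq_zero _ 2 9 (by simp), add_zero, add_zero, add_zero, add_zero, add_zero]
  have hm : (X 0 ^ 4 * X 2 ^ 8 * X 3 ^ 4 * X 4 ^ 2 : MvPolynomial (Fin 5) k) =
      monomial (Finsupp.equivFunOnFinite.symm ![4, 0, 8, 4, 2]) 1 := by
    rw [monomial_five, pow_zero, mul_one]
  rw [hm, show (36 : MvPolynomial (Fin 5) k) = C 36 from (map_ofNat C 36).symm, coeff_C_mul, coeff_monomial,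
    if_pos rfl, mul_one]

/-- `x⁸w⁴Z⁴U³` has coefficient `12` in `(F₁F₂)⁴`. [folklore] -/
theorem coeff_witness_x (F₁ F₂ : MvPolynomial (Fin 5) k)
    (hF₁ : F₁ = X 0 ^ 2 + X 1 ^ 3 - X 2 * X 4) (hF₂ : F₂ = X 3 ^ 2 + X 2 * X 4 ^ 3 + X 2 ^ 3) :
    coeff (Finsupp.equivFunOnFinite.symm ![8, 0, 4, 4, 3]) ((F₁ * F₂) ^ 4) = 12 := by
  rw [hF₁, hF₂, pow4_split_y, expand_y0_x, coeff_add, coeff_add, coeff_add, coeff_add,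
    coeff_X_pow_mul_eq_zero _ 1 3 (by simp), coeff_X_pow_mul_eq_zero _ 2 5 (by simp),
    coeff_X_pow_mul_eq_zero _ 3 5 (by simp), coeff_X_pow_mul_eq_zero _ 4 5 (by simp),
    add_zero, add_zero, add_zero, add_zero]
  have hm : (X 0 ^ 8 * X 2 ^ 4 * X 3 ^ 4 * X 4 ^ 3 : MvPolynomial (Fin 5) k) =
      monomial (Finsupp.equivFunOnFinite.symm ![8, 0, 4, 4, 3]) 1 := by
    rw [monomial_five, pow_zero, mul_one]
  rw [hm, show (12 : MvPolynomial (Fin 5) k) = C 12 from (map_ofNat C 12).symm, coeff_C_mul, coeff_monomial,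
    if_pos rfl, mul_one]

end Coeff

/-! ## §4 Weighted homogeneity and the singleton classes -/

section Weights

variable {k : Type} [Field k]

/-- `F₁ = x²+y³−wU` is weighted homogeneous of degree `30` for `(15,10,18,27,12)`. [folklore] -/
theorem isWeightedHomogeneous_F₁ (F₁ : MvPolynomial (Fin 5) k) (hF₁ : F₁ = X 0 ^ 2 + X 1 ^ 3 - X 2 * X 4) :
    IsWeightedHomogeneous (![15, 10, 18, 27, 12] : Fin 5 → ℕ) F₁ 30 := by
  rw [hF₁]
  have h0 := (isWeightedHomogeneous_X k (![15, 10, 18, 27, 12] : Fin 5 → ℕ) 0).pow 2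
  have h1 := (isWeightedHomogeneous_X k (![15, 10, 18, 27, 12] : Fin 5 → ℕ) 1).pow 3
  have h24 := (isWeightedHomogeneous_X k (![15, 10, 18, 27, 12] : Fin 5 → ℕ) 2).mul
    (isWeightedHomogeneous_X k (![15, 10, 18, 27, 12] : Fin 5 → ℕ) 4)
  norm_num at h0 h1 h24
  have hs := Submodule.sub_mem _ ((mem_weightedHomogeneousSubmodule _ _ _ _).mpr (h0.add h1))
    ((mem_weightedHomogeneousSubmodule _ _ _ _).mpr h24)
  exact (mem_weightedHomogeneousSubmodule _ _ _ _).mp hs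

/-- `F₂ = Z²+wU³+w³` is weighted homogeneous of degree `54` for `(15,10,18,27,12)`. [folklore] -/
theorem isWeightedHomogeneous_F₂ (F₂ : MvPolynomial (Fin 5) k) (hF₂ : F₂ = X 3 ^ 2 + X 2 * X 4 ^ 3 + X 2 ^ 3) :
    IsWeightedHomogeneous (![15, 10, 18, 27, 12] : Fin 5 → ℕ) F₂ 54 := by
  rw [hF₂]
  have h3 := (isWeightedHomogeneous_X k (![15, 10, 18, 27, 12] : Fin 5 → ℕ) 3).pow 2
  have h24 := (isWeightedHomogeneous_X k (![15, 10, 18, 27, 12] : Fin 5 → ℕ) 2).mul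
    ((isWeightedHomogeneous_X k (![15, 10, 18, 27, 12] : Fin 5 → ℕ) 4).pow 3)
  have h2 := (isWeightedHomogeneous_X k (![15, 10, 18, 27, 12] : Fin 5 → ℕ) 2).pow 3
  norm_num at h3 h24 h2
  exact (h3.add h24).add h2

/-- `(F₁F₂)⁴` is weighted homogeneous of degree `336`. [folklore] -/
theorem isWeightedHomogeneous_pow4 (F₁ F₂ : MvPolynomial (Fin 5) k)
    (hF₁ : F₁ = X 0 ^ 2 + X 1 ^ 3 - X 2 * X 4) (hF₂ : F₂ = X 3 ^ 2 + X 2 * X 4 ^ 3 + X 2 ^ 3) :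
    IsWeightedHomogeneous (![15, 10, 18, 27, 12] : Fin 5 → ℕ) ((F₁ * F₂) ^ 4) 336 := by
  have h := ((isWeightedHomogeneous_F₁ F₁ hF₁).mul (isWeightedHomogeneous_F₂ F₂ hF₂)).pow 4
  norm_num at h
  exact h

/-- The weight of an exponent vector of `k[x,y,w,Z,U]` in coordinates. [folklore] -/
theorem weight_five (γ : Fin 5 →₀ ℕ) :
    Finsupp.weight (![15, 10, 18, 27, 12] : Fin 5 → ℕ) γ = 15 * γ 0 + 10 * γ 1 + 18 * γ 2 + 27 * γ 3 + 12 * γ 4 := by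
  rw [Finsupp.weight_apply, Finsupp.sum_fintype _ _ (fun i => by simp)]
  simp only [Fin.sum_univ_five, smul_eq_mul, Matrix.cons_val_zero, Matrix.cons_val_one, Matrix.cons_val]
  ring

/-- `75t₀+50t₁+90t₂+135t₃+60t₄ ∈ {60, 90, 75}` pins `t` (the weight count behind the three singleton classes).
[folklore] -/
theorem arith_t (t0 t1 t2 t3 t4 : ℕ) :
    (75 * t0 + 50 * t1 + 90 * t2 + 135 * t3 + 60 * t4 = 60 → t0 = 0 ∧ t1 = 0 ∧ t2 = 0 ∧ t3 = 0 ∧ t4 = 1) ∧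
    (75 * t0 + 50 * t1 + 90 * t2 + 135 * t3 + 60 * t4 = 90 → t0 = 0 ∧ t1 = 0 ∧ t2 = 1 ∧ t3 = 0 ∧ t4 = 0) ∧
    (75 * t0 + 50 * t1 + 90 * t2 + 135 * t3 + 60 * t4 = 75 → t0 = 1 ∧ t1 = 0 ∧ t2 = 0 ∧ t3 = 0 ∧ t4 = 0) := by
  refine ⟨fun hw => ?_, fun hw => ?_, fun hw => ?_⟩ <;>
  · have b0 : t0 ≤ 1 := by omega
    have b1 : t1 ≤ 1 := by omega
    have b2 : t2 ≤ 1 := by omega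
    have b3 : t3 ≤ 1 := by omega
    have b4 : t4 ≤ 1 := by omega
    interval_cases t0 <;> interval_cases t1 <;> interval_cases t2 <;> interval_cases t3 <;> interval_cases t4 <;> omega

/-- **The three witness classes are singletons** among exponents of weight `336`: an exponent of weight `336` congruent
mod `5` to `x⁴w⁴Z⁴U⁸`, resp. `x⁴w⁸Z⁴U²`, resp. `x⁸w⁴Z⁴U³`, equals it. [folklore] -/
theorem arith_witness (a0 a1 a2 a3 a4 : ℕ) (hw : 15 * a0 + 10 * a1 + 18 * a2 + 27 * a3 + 12 * a4 = 336) :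
    (a0 % 5 = 4 → a1 % 5 = 0 → a2 % 5 = 4 → a3 % 5 = 4 → a4 % 5 = 3 → a0 = 4 ∧ a1 = 0 ∧ a2 = 4 ∧ a3 = 4 ∧ a4 = 8) ∧
    (a0 % 5 = 4 → a1 % 5 = 0 → a2 % 5 = 3 → a3 % 5 = 4 → a4 % 5 = 2 → a0 = 4 ∧ a1 = 0 ∧ a2 = 8 ∧ a3 = 4 ∧ a4 = 2) ∧
    (a0 % 5 = 3 → a1 % 5 = 0 → a2 % 5 = 4 → a3 % 5 = 4 → a4 % 5 = 3 → a0 = 8 ∧ a1 = 0 ∧ a2 = 4 ∧ a3 = 4 ∧ a4 = 3) := by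
  have d0 := Nat.div_add_mod a0 5
  have d1 := Nat.div_add_mod a1 5
  have d2 := Nat.div_add_mod a2 5
  have d3 := Nat.div_add_mod a3 5
  have d4 := Nat.div_add_mod a4 5
  generalize a0 / 5 = t0 at d0
  generalize a1 / 5 = t1 at d1
  generalize a2 / 5 = t2 at d2
  generalize a3 / 5 = t3 at d3
  generalize a4 / 5 = t4 at d4
  have ht := arith_t t0 t1 t2 t3 t4
  refine ⟨fun h0 h1 h2 h3 h4 => ?_, fun h0 h1 h2 h3 h4 => ?_, fun h0 h1 h2 h3 h4 => ?_⟩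
  · rw [h0] at d0; rw [h1] at d1; rw [h2] at d2; rw [h3] at d3; rw [h4] at d4
    clear h0 h1 h2 h3 h4
    subst d0 d1 d2 d3 d4
    obtain ⟨e0, e1, e2, e3, e4⟩ := ht.1 (by omega)
    subst e0 e1 e2 e3 e4
    norm_num
  · rw [h0] at d0; rw [h1] at d1; rw [h2] at d2; rw [h3] at d3; rw [h4] at d4
    clear h0 h1 h2 h3 h4
    subst d0 d1 d2 d3 d4
    obtain ⟨e0, e1, e2, e3, e4⟩ := ht.2.1 (by omega)
    subst e0 e1 e2 e3 e4
    norm_num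
  · rw [h0] at d0; rw [h1] at d1; rw [h2] at d2; rw [h3] at d3; rw [h4] at d4
    clear h0 h1 h2 h3 h4
    subst d0 d1 d2 d3 d4
    obtain ⟨e0, e1, e2, e3, e4⟩ := ht.2.2 (by omega)
    subst e0 e1 e2 e3 e4
    norm_num

/-- Exponent vectors of `k[X₀,…,X₄]` from their five coordinates. [folklore] -/
theorem eq_equivFunOnFinite_symm (γ : Fin 5 →₀ ℕ) (v : Fin 5 → ℕ) (h0 : γ 0 = v 0) (h1 : γ 1 = v 1) (h2 : γ 2 = v 2)
    (h3 : γ 3 = v 3) (h4 : γ 4 = v 4) : γ = Finsupp.equivFunOnFinite.symm v := by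
  refine Finsupp.ext fun i => ?_
  rw [Finsupp.coe_equivFunOnFinite_symm]
  fin_cases i
  · exact h0
  · exact h1
  · exact h2
  · exact h3
  · exact h4

/-- The singleton hypothesis of `fedder_of_singleton_support` for a witness of `(F₁F₂)⁴`, from weights. [folklore] -/
theorem hsing_of_weight (F₁ F₂ : MvPolynomial (Fin 5) k)
    (hF₁ : F₁ = X 0 ^ 2 + X 1 ^ 3 - X 2 * X 4) (hF₂ : F₂ = X 3 ^ 2 + X 2 * X 4 ^ 3 + X 2 ^ 3)
    (γ₀ : Fin 5 →₀ ℕ)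
    (huniq : ∀ γ : Fin 5 →₀ ℕ, Finsupp.weight (![15, 10, 18, 27, 12] : Fin 5 → ℕ) γ = 336 →
      (∀ i : Fin 5, γ i % 5 = γ₀ i % 5) → γ = γ₀) :
    ∀ γ ∈ ((F₁ * F₂) ^ (5 - 1)).support, (∀ i : Fin 5, γ i % 5 = γ₀ i % 5) → γ = γ₀ := by
  intro γ hγ hmod
  have hw := isWeightedHomogeneous_pow4 F₁ F₂ hF₁ hF₂ (mem_support_iff.mp hγ)
  exact huniq γ hw hmod

end Weights

/-! ## §5 Fedder's test at the three kinds of points, characteristic `5` -/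

section Fedder

variable {k : Type} [Field k] [CharP k 5]

/-- In characteristic `5`, `36 ≠ 0` and `12 ≠ 0`. [folklore] -/
theorem units_char5 : (36 : k) ≠ 0 ∧ (12 : k) ≠ 0 := by
  haveI : Fact (Nat.Prime 5) := ⟨Nat.prime_five⟩
  constructor
  · intro h
    have h' : ((36 : ℕ) : k) = 0 := by exact_mod_cast h
    rw [CharP.cast_eq_zero_iff k 5] at h'
    omega
  · intro h
    have h' : ((12 : ℕ) : k) = 0 := by exact_mod_cast h
    rw [CharP.cast_eq_zero_iff k 5] at h'
    omega

/-- **Fedder's test for the cone over `P` at points with `b_U ≠ 0`** (`p = 5`): `((F₁F₂) ⊗ K)⁴ ∉ ((Xᵢ − bᵢ)⁵)`. Witness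
`x⁴w⁴Z⁴U⁸`. [cite: Fedder1983, Prop. 1.7 and Prop. 2.1] -/
theorem pCone_fedder_U (F₁ F₂ : MvPolynomial (Fin 5) k)
    (hF₁ : F₁ = X 0 ^ 2 + X 1 ^ 3 - X 2 * X 4) (hF₂ : F₂ = X 3 ^ 2 + X 2 * X 4 ^ 3 + X 2 ^ 3)
    {K : Type} [Field K] [Algebra k K] (b : Fin 5 → K) (hb : b 4 ≠ 0) :
    (MvPolynomial.map (algebraMap k K) (F₁ * F₂)) ^ (5 - 1) ∉
      Ideal.span (Set.range fun i : Fin 5 => (MvPolynomial.X i - MvPolynomial.C (b i)) ^ 5) := by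
  haveI : Fact (Nat.Prime 5) := ⟨Nat.prime_five⟩
  refine fedder_of_singleton_support 5 (F₁ * F₂)
    (Finsupp.equivFunOnFinite.symm ![4, 0, 4, 4, 8]) ?_ ?_ b ?_
  · rw [show 5 - 1 = 4 from rfl, coeff_witness_U F₁ F₂ hF₁ hF₂]
    exact units_char5.1
  · refine hsing_of_weight F₁ F₂ hF₁ hF₂ _ fun γ hw hmod => ?_
    rw [weight_five] at hw
    obtain ⟨e0, e1, e2, e3, e4⟩ := (arith_witness _ _ _ _ _ hw).1 (by simpa using hmod 0) (by simpa using hmod 1)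
      (by simpa using hmod 2) (by simpa using hmod 3) (by simpa using hmod 4)
    exact eq_equivFunOnFinite_symm γ _ e0 e1 e2 e3 e4
  · intro i hi
    simp only [Finsupp.coe_equivFunOnFinite_symm] at hi
    fin_cases i <;> norm_num at hi
    exact hb

/-- **Fedder's test for the cone over `P` at points with `b_w ≠ 0`** (`p = 5`). Witness `x⁴w⁸Z⁴U²`.
[cite: Fedder1983, Prop. 1.7 and Prop. 2.1] -/
theorem pCone_fedder_w (F₁ F₂ : MvPolynomial (Fin 5) k)
    (hF₁ : F₁ = X 0 ^ 2 + X 1 ^ 3 - X 2 * X 4) (hF₂ : F₂ = X 3 ^ 2 + X 2 * X 4 ^ 3 + X 2 ^ 3)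
    {K : Type} [Field K] [Algebra k K] (b : Fin 5 → K) (hb : b 2 ≠ 0) :
    (MvPolynomial.map (algebraMap k K) (F₁ * F₂)) ^ (5 - 1) ∉
      Ideal.span (Set.range fun i : Fin 5 => (MvPolynomial.X i - MvPolynomial.C (b i)) ^ 5) := by
  haveI : Fact (Nat.Prime 5) := ⟨Nat.prime_five⟩
  refine fedder_of_singleton_support 5 (F₁ * F₂)
    (Finsupp.equivFunOnFinite.symm ![4, 0, 8, 4, 2]) ?_ ?_ b ?_
  · rw [show 5 - 1 = 4 from rfl, coeff_witness_w F₁ F₂ hF₁ hF₂]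
    exact units_char5.1
  · refine hsing_of_weight F₁ F₂ hF₁ hF₂ _ fun γ hw hmod => ?_
    rw [weight_five] at hw
    obtain ⟨e0, e1, e2, e3, e4⟩ := (arith_witness _ _ _ _ _ hw).2.1 (by simpa using hmod 0) (by simpa using hmod 1)
      (by simpa using hmod 2) (by simpa using hmod 3) (by simpa using hmod 4)
    exact eq_equivFunOnFinite_symm γ _ e0 e1 e2 e3 e4
  · intro i hi
    simp only [Finsupp.coe_equivFunOnFinite_symm] at hi
    fin_cases i <;> norm_num at hi
    exact hb

/-- **Fedder's test for the cone over `P` at points with `b_x ≠ 0`** (`p = 5`). Witness `x⁸w⁴Z⁴U³`.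
[cite: Fedder1983, Prop. 1.7 and Prop. 2.1] -/
theorem pCone_fedder_x (F₁ F₂ : MvPolynomial (Fin 5) k)
    (hF₁ : F₁ = X 0 ^ 2 + X 1 ^ 3 - X 2 * X 4) (hF₂ : F₂ = X 3 ^ 2 + X 2 * X 4 ^ 3 + X 2 ^ 3)
    {K : Type} [Field K] [Algebra k K] (b : Fin 5 → K) (hb : b 0 ≠ 0) :
    (MvPolynomial.map (algebraMap k K) (F₁ * F₂)) ^ (5 - 1) ∉
      Ideal.span (Set.range fun i : Fin 5 => (MvPolynomial.X i - MvPolynomial.C (b i)) ^ 5) := by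
  haveI : Fact (Nat.Prime 5) := ⟨Nat.prime_five⟩
  refine fedder_of_singleton_support 5 (F₁ * F₂)
    (Finsupp.equivFunOnFinite.symm ![8, 0, 4, 4, 3]) ?_ ?_ b ?_
  · rw [show 5 - 1 = 4 from rfl, coeff_witness_x F₁ F₂ hF₁ hF₂]
    exact units_char5.2
  · refine hsing_of_weight F₁ F₂ hF₁ hF₂ _ fun γ hw hmod => ?_
    rw [weight_five] at hw
    obtain ⟨e0, e1, e2, e3, e4⟩ := (arith_witness _ _ _ _ _ hw).2.2 (by simpa using hmod 0) (by simpa using hmod 1)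
      (by simpa using hmod 2) (by simpa using hmod 3) (by simpa using hmod 4)
    exact eq_equivFunOnFinite_symm γ _ e0 e1 e2 e3 e4
  · intro i hi
    simp only [Finsupp.coe_equivFunOnFinite_symm] at hi
    fin_cases i <;> norm_num at hi
    exact hb

end Fedder

end Summit.ResolutionOfSingularities.ResolutionOfSingularities.Theorems.FInjectiveMacaulayfication.PConeFedderData

end
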